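import Mathlib
import HarnessLib
import Summits.NavierStokesRegularity.NavierStokesRegularity.Theorems.StretchingWellBindingEnstrophyQuarterLawSparsenessFarField
import Summits.NavierStokesRegularity.NavierStokesRegularity.Theorems.StretchingWellBindingEnstrophyQuarterLawSparsenessTools
import Summits.NavierStokesRegularity.NavierStokesRegularity.Theorems.StretchingWellBindingEnstrophyQuarterLawSparseness
import Summits.NavierStokesRegularity.NavierStokesRegularity.Theorems.StretchingWellBindingEnstrophyQuarterLawSparsenessEarly

/-!
# Shelf 1574, line `sparse_sieve`: UNIFORM SPARSENESS at coarse scales, and the assembly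
# window law + far field ⇒ the conclusion of `stub_uniformSparseness`

Helper file (`--supports stmt-NavierStokesRegularity-1574 --as helper`). It closes the residual named in
the g0 repair census of leafhand-ns-efficiencyfloor-1 ("late times at COARSE scales `ϑ(ε₀) r₁ < r ≤ r₀` —
near field by volume packing in a fixed ball, far field by an exterior `L³` bound") and assembles the three
regimes into the conclusion of the registered stub S2 of `Cruxes/EnstrophyQuarterLaw/Lines/sparse_sieve.lean`,
predicate `UniformSparseness T u` unfolded verbatim:

* `exists_exterior_norm_cube_le`, `farField_norm_cube_le` — packaged forms of the exterior `L³` bound of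
  `…SparsenessFarField` (one absolute constant; applied to a Leray–Hopf classical solution whose exterior
  enstrophy stays bounded on `[T/2, T)`: `∃ ρ₁ > 0, C₃ ≥ 0, ∀ t ∈ [T/2, T), ∫_{|x| ≥ ρ₁} |u(t)|³ ≤ C₃`);
* `sparse_coarse_of_farField` — LATE times, scales in a fixed band `[r_min, r₀]`: centres with
  `‖x‖ < ρ₁ + 2r₀` are counted by volume packing (`SparsenessTools.card_filter_mem_ball_le_of_separated`), the
  others see only the far field, where bounded overlap and the exterior `L³` bound give `card · ε₀³ ≤ 8 C₃`;
* `uniformSparseness_of_window` — classical on `[0, T)`, Leray–Hopf, rapidly decaying datum, window law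
  `∫_a^b ∫ |curl u|² ≤ K √(b − a)`, exterior enstrophy bounded on `[T/2, T)` ⟹ the S2 conclusion
  (`sparse_early_of_lerayHopf` for `t ≤ T/2`; `sparse_fine_of_window` for `t ≥ T/2`, `r ≤ ϑ r₁`;
  `sparse_coarse_of_farField` for `t ≥ T/2`, `ϑ r₁ ≤ r ≤ r₁`);

The BY-NAME corollaries (`EnergyHalfHolder ⇒ S2`, `EnstrophyQuarterLaw ⇒ S2`, and the characterisation
`EnergyHalfHolder ⟺ (∀ S1) ∧ (∀ S2)`) are in `…SparseSieveCharacterisation` (this module imports no route file).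

HONEST FRAMING: conditional bookkeeping (an OPEN statement implies an OPEN statement); nothing here bears on
the regularity problem; `EnstrophyQuarterLaw` (1574), `UniformSparseness` (S2) and `TypeIliouvilleNoTypeII`
(0056) stay OPEN. No summit statement is proved.
-/

noncomputable section

-- the summit-side namespace repeats a component by design (D-0017)
set_option linter.dupNamespace false

namespace Summit.NavierStokesRegularity.NavierStokesRegularity.Theorems.EnstrophyQuarterLaw.SparsenessCoarse

open Set MeasureTheory Function Metric Filter Topology
open scoped ENNReal NNReal
open Literature.Analysis.FluidPDE

/-! ### The exterior `L³` bound, packaged -/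

/-- **Exterior `L³` from energy and exterior enstrophy, with an absolute constant**: there is `Λ ≥ 0`
such that for every `C²` divergence-free field `v` on `ℝ³` with `∫⁻ ‖v‖ₑ² ≤ E₂` and
`∫⁻_{|x| ≥ ρ} ‖curl v‖ₑ² ≤ B` (`E₂, B ≥ 0`, `ρ > 0`): `∫⁻_{|x| ≥ 2ρ} ‖v‖ₑ³ ≤ Λ E₂^{3/4} (B + E₂/ρ²)^{3/4}`.
(`Λ = K^{3/2} (2 + 132 C²)^{3/4}`, `K` the GNS constant, `C` the cut-off gradient constant.) [folklore] -/
theorem exists_exterior_norm_cube_le : ∃ Λ : ℝ, 0 ≤ Λ ∧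
    ∀ (v : EuclideanSpace ℝ (Fin 3) → EuclideanSpace ℝ (Fin 3)), ContDiff ℝ 2 v →
      VectorCalculus.IsDivFree v → ∀ (E₂ B ρ : ℝ), 0 ≤ E₂ → 0 ≤ B → 0 < ρ →
      ∫⁻ x, ‖v x‖ₑ ^ 2 ≤ ENNReal.ofReal E₂ →
      ∫⁻ x in (ball (0 : EuclideanSpace ℝ (Fin 3)) ρ)ᶜ, ‖curl v x‖ₑ ^ 2 ≤ ENNReal.ofReal B →
      ∫⁻ x in (ball (0 : EuclideanSpace ℝ (Fin 3)) (2 * ρ))ᶜ, ‖v x‖ₑ ^ 3 ≤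
        ENNReal.ofReal (Λ * E₂ ^ (3 / 4 : ℝ) * (B + E₂ / ρ ^ 2) ^ (3 / 4 : ℝ)) := by
  obtain ⟨C, hC0, hC⟩ := exists_norm_fderiv_cutoff_le (E := EuclideanSpace ℝ (Fin 3))
  set K : ℝ := (SNormLESNormFDerivOfEqConst (EuclideanSpace ℝ (Fin 3))
    (volume : Measure (EuclideanSpace ℝ (Fin 3))) 2 : ℝ) with hK
  have hK0 : 0 ≤ K := NNReal.coe_nonneg _
  refine ⟨K ^ (3 / 2 : ℝ) * (2 + 132 * C ^ 2) ^ (3 / 4 : ℝ), by positivity, ?_⟩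
  intro v hv hdiv E₂ B ρ hE₂ hB hρ h2 hcurl
  refine (SparsenessFarField.lintegral_exterior_norm_cube_le hC0 hC hv hdiv hE₂ hB hρ h2 hcurl).trans
    (ENNReal.ofReal_le_ofReal ?_)
  have hρ2 : 0 < ρ ^ 2 := pow_pos hρ 2
  have hx : 2 * B + 33 * (2 * C / ρ) ^ 2 * E₂ ≤ (2 + 132 * C ^ 2) * (B + E₂ / ρ ^ 2) := by
    have e : 33 * (2 * C / ρ) ^ 2 * E₂ = 132 * C ^ 2 * (E₂ / ρ ^ 2) := by
      field_simp
      ring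
    rw [e]
    have h1 : 0 ≤ E₂ / ρ ^ 2 := by positivity
    nlinarith [sq_nonneg C, hB, h1]
  have hx0 : 0 ≤ 2 * B + 33 * (2 * C / ρ) ^ 2 * E₂ := by positivity
  calc K ^ (3 / 2 : ℝ) * E₂ ^ (3 / 4 : ℝ) * (2 * B + 33 * (2 * C / ρ) ^ 2 * E₂) ^ (3 / 4 : ℝ)
      ≤ K ^ (3 / 2 : ℝ) * E₂ ^ (3 / 4 : ℝ) * ((2 + 132 * C ^ 2) * (B + E₂ / ρ ^ 2)) ^ (3 / 4 : ℝ) := by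
        gcongr
    _ = K ^ (3 / 2 : ℝ) * (2 + 132 * C ^ 2) ^ (3 / 4 : ℝ) * E₂ ^ (3 / 4 : ℝ) *
          (B + E₂ / ρ ^ 2) ^ (3 / 4 : ℝ) := by
        rw [Real.mul_rpow (by positivity) (by positivity)]
        ring

/-! ### The far field of a Leray–Hopf classical solution at late times -/

/-- **Far-field `L³` bound at late times.** For a classical solution on `[0, T)` (`ν > 0`), Leray–Hopf on
`[0, T]`, whose enstrophy outside some ball `B(0, ρ)` stays `≤ B` on `[T/2, T)` (the conclusion of the line's
`FarFieldEnstrophy`, landed as `…FarFieldEnstrophy.stub_farFieldEnstrophy`): there are `ρ₁ > 0` and `C₃ ≥ 0`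
with `∫_{|x| ≥ ρ₁} |u(t)|³ ≤ C₃` for all `t ∈ [T/2, T)` (energy `≤ 2E₀` + `exists_exterior_norm_cube_le`).
[folklore] -/
theorem farField_norm_cube_le {ν T : ℝ} {u : ℝ → EuclideanSpace ℝ (Fin 3) → EuclideanSpace ℝ (Fin 3)}
    {p : ℝ → EuclideanSpace ℝ (Fin 3) → ℝ} (hν : 0 < ν)
    (hsol : IsClassicalNSSolutionOn (Ico 0 T) ν 0 u p) (hLH : IsLerayHopfOn T ν 0 (u 0) u)
    {ρ B : ℝ} (hB : 0 ≤ B)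
    (hFF : ∀ t ∈ Ico (T / 2) T,
      ∫⁻ x in (ball (0 : EuclideanSpace ℝ (Fin 3)) ρ)ᶜ, ‖curl (u t) x‖ₑ ^ 2 ≤ ENNReal.ofReal B) :
    ∃ ρ₁ C₃ : ℝ, 0 < ρ₁ ∧ 0 ≤ C₃ ∧ ∀ t ∈ Ico (T / 2) T,
      ∫⁻ x in (ball (0 : EuclideanSpace ℝ (Fin 3)) ρ₁)ᶜ, ‖u t x‖ₑ ^ 3 ≤ ENNReal.ofReal C₃ := by
  obtain ⟨Λ, hΛ0, hΛ⟩ := exists_exterior_norm_cube_le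
  set ρ' : ℝ := max ρ 1 with hρ'
  have hρ'pos : 0 < ρ' := lt_of_lt_of_le one_pos (le_max_right _ _)
  set E₂ : ℝ := 2 * VectorCalculus.kineticEnergy (u 0) with hE₂
  have hE₂0 : 0 ≤ E₂ := mul_nonneg zero_le_two (kineticEnergy_nonneg (u 0))
  refine ⟨2 * ρ', Λ * E₂ ^ (3 / 4 : ℝ) * (B + E₂ / ρ' ^ 2) ^ (3 / 4 : ℝ), by positivity, by positivity,
    fun t ht => ?_⟩
  have hT : 0 < T := by linarith [ht.1, ht.2]
  have htI : t ∈ Ico 0 T := ⟨by linarith [ht.1], ht.2⟩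
  have htc : t ∈ Icc 0 T := ⟨htI.1, htI.2.le⟩
  have hv : ContDiff ℝ 2 (u t) := (hsol.contDiff_velocity htI).of_le (by norm_cast)
  have hsub : (ball (0 : EuclideanSpace ℝ (Fin 3)) ρ')ᶜ ⊆ (ball (0 : EuclideanSpace ℝ (Fin 3)) ρ)ᶜ :=
    compl_subset_compl.2 (ball_subset_ball (le_max_left _ _))
  exact hΛ (u t) hv (hsol.divFree t htI) E₂ B ρ' hE₂0 hB hρ'pos (hLH.lintegral_enorm_sq_le hν.le htc)
    ((lintegral_mono_set hsub).trans (hFF t ht))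

/-! ### Uniform sparseness at coarse scales (late times) -/

variable {ν T : ℝ} {u : ℝ → EuclideanSpace ℝ (Fin 3) → EuclideanSpace ℝ (Fin 3)}
  {p : ℝ → EuclideanSpace ℝ (Fin 3) → ℝ}

/-- **Uniform sparseness at coarse scales, late times.** For a classical solution on `[0, T)` (`ν > 0`),
Leray–Hopf on `[0, T]`, whose enstrophy outside `B(0, ρ)` stays `≤ B` on `[T/2, T)`, and a band of scales
`0 < r_min ≤ r₀`: for every `ε₀ > 0` there is `N₀` such that for all `t ∈ [T/2, T)`, `r ∈ [r_min, r₀]` and every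
finite `4r`-separated family `F` of centres with `∫_{B(x, 2r)} |u(t)|³ ≥ ε₀³`, `card F ≤ N₀` (near field:
volume packing in `B(0, ρ₁ + 2r₀)`; far field: bounded overlap + `farField_norm_cube_le`). [folklore] -/
theorem sparse_coarse_of_farField (hν : 0 < ν)
    (hsol : IsClassicalNSSolutionOn (Ico 0 T) ν 0 u p) (hLH : IsLerayHopfOn T ν 0 (u 0) u)
    {ρ B : ℝ} (hB : 0 ≤ B)
    (hFF : ∀ t ∈ Ico (T / 2) T,
      ∫⁻ x in (ball (0 : EuclideanSpace ℝ (Fin 3)) ρ)ᶜ, ‖curl (u t) x‖ₑ ^ 2 ≤ ENNReal.ofReal B)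
    {rmin r₀ : ℝ} (hrmin : 0 < rmin) (hr₀ : rmin ≤ r₀) :
    ∀ ε₀ : ℝ, 0 < ε₀ → ∃ N₀ : ℕ, ∀ t ∈ Ico (T / 2) T, ∀ r ∈ Icc rmin r₀,
      ∀ F : Finset (EuclideanSpace ℝ (Fin 3)),
        (∀ x ∈ F, ∀ y ∈ F, x ≠ y → 4 * r ≤ dist x y) →
        (∀ x ∈ F, ENNReal.ofReal (ε₀ ^ 3) ≤ ∫⁻ y in ball x (2 * r), ‖u t y‖ₑ ^ 3) →
        F.card ≤ N₀ := by
  classical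
  intro ε₀ hε₀
  obtain ⟨ρ₁, C₃, hρ₁, hC₃, hfar⟩ := farField_norm_cube_le hν hsol hLH hB hFF
  have hr₀pos : 0 < r₀ := hrmin.trans_le hr₀
  set Nn : ℕ := ⌊((ρ₁ + 4 * r₀) / (2 * rmin)) ^ 3⌋₊ with hNn
  set Nf : ℕ := ⌊8 * C₃ / ε₀ ^ 3⌋₊ with hNf
  refine ⟨Nn + Nf, fun t ht r hr F hsep hconc => ?_⟩
  have hrpos : 0 < r := hrmin.trans_le hr.1
  have htI : t ∈ Ico 0 T := ⟨by linarith [ht.1, ht.2], ht.2⟩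
  -- ### near field: volume packing in `B(0, ρ₁ + 2r₀)`
  set P : EuclideanSpace ℝ (Fin 3) → Prop := fun x => (0 : EuclideanSpace ℝ (Fin 3)) ∈ ball x (ρ₁ + 2 * r₀)
    with hP
  have hnear : ((F.filter P).card : ℝ) ≤ ((ρ₁ + 4 * r₀) / (2 * rmin)) ^ 3 := by
    have h := SparsenessTools.card_filter_mem_ball_le_of_separated (s := 4 * r) (ρ := ρ₁ + 2 * r₀)
      (by positivity) (by positivity) F hsep 0
    refine h.trans (pow_le_pow_left₀ (by positivity) ?_ 3)
    rw [div_le_div_iff₀ (by positivity) (by positivity)]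
    have h1 : rmin ≤ r := hr.1
    have h2 : r ≤ r₀ := hr.2
    nlinarith [hρ₁.le, hr₀pos.le, hrmin.le]
  have hnearN : (F.filter P).card ≤ Nn := by
    refine Nat.le_floor ?_
    exact_mod_cast hnear
  -- ### far field: the balls of the remaining centres lie outside `B(0, ρ₁)`
  set S : Set (EuclideanSpace ℝ (Fin 3)) := (ball (0 : EuclideanSpace ℝ (Fin 3)) ρ₁)ᶜ with hS
  have hSm : MeasurableSet S := measurableSet_ball.compl
  have hballS : ∀ x ∈ F.filter (fun x => ¬ P x), ball x (2 * r) ⊆ S := by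
    intro x hx y hy
    have hx' : ¬ (0 : EuclideanSpace ℝ (Fin 3)) ∈ ball x (ρ₁ + 2 * r₀) := (Finset.mem_filter.1 hx).2
    rw [mem_ball, dist_comm, dist_zero_right, not_lt] at hx'
    rw [hS, mem_compl_iff, mem_ball, dist_zero_right, not_lt]
    rw [mem_ball] at hy
    have h1 : ‖x‖ ≤ ‖y‖ + dist y x := by
      have := norm_le_norm_add_norm_sub' x y  -- ‖x‖ ≤ ‖y‖ + ‖x - y‖
      rw [← dist_eq_norm, dist_comm] at this
      exact this
    linarith [hr.2]
  set g : EuclideanSpace ℝ (Fin 3) → ℝ≥0∞ := S.indicator fun y => ‖u t y‖ₑ ^ 3 with hg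
  have hcont : Continuous (u t) := (hsol.contDiff_velocity htI).continuous
  have hgm : AEMeasurable g volume :=
    ((hcont.measurable.enorm.pow_const _).indicator hSm).aemeasurable
  have hsepf : ∀ x ∈ F.filter (fun x => ¬ P x), ∀ y ∈ F.filter (fun x => ¬ P x), x ≠ y →
      4 * r ≤ dist x y := fun x hx y hy hxy =>
    hsep x (Finset.mem_filter.1 hx).1 y (Finset.mem_filter.1 hy).1 hxy
  have hsum := SparsenessTools.sum_setLIntegral_ball_le_of_separated (s := 4 * r) (ρ := 2 * r)
    (by positivity) (by positivity) (F.filter (fun x => ¬ P x)) hsepf hgm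
  have e8 : ((2 * r + 4 * r / 2) / (4 * r / 2)) ^ 3 = (8 : ℝ) := by
    field_simp
    ring
  rw [e8] at hsum
  have hgint : ∫⁻ y, g y ≤ ENNReal.ofReal C₃ := by
    rw [hg, lintegral_indicator hSm]
    exact hfar t ht
  have hcard : ((F.filter (fun x => ¬ P x)).card : ℝ≥0∞) * ENNReal.ofReal (ε₀ ^ 3) ≤
      ENNReal.ofReal (8 * C₃) := by
    calc ((F.filter (fun x => ¬ P x)).card : ℝ≥0∞) * ENNReal.ofReal (ε₀ ^ 3)
        = ∑ x ∈ F.filter (fun x => ¬ P x), ENNReal.ofReal (ε₀ ^ 3) := by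
          rw [Finset.sum_const, nsmul_eq_mul]
      _ ≤ ∑ x ∈ F.filter (fun x => ¬ P x), ∫⁻ y in ball x (2 * r), g y := by
          refine Finset.sum_le_sum fun x hx => (hconc x (Finset.mem_filter.1 hx).1).trans (le_of_eq ?_)
          rw [hg, ← lintegral_indicator measurableSet_ball, ← lintegral_indicator measurableSet_ball]
          refine lintegral_congr fun y => ?_
          by_cases hy : y ∈ ball x (2 * r)
          · rw [indicator_of_mem hy, indicator_of_mem hy, indicator_of_mem (hballS x hx hy)]
          · rw [indicator_of_notMem hy, indicator_of_notMem hy]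
      _ ≤ ENNReal.ofReal 8 * ∫⁻ y, g y := hsum
      _ ≤ ENNReal.ofReal 8 * ENNReal.ofReal C₃ := mul_le_mul' le_rfl hgint
      _ = ENNReal.ofReal (8 * C₃) := by rw [← ENNReal.ofReal_mul (by norm_num)]
  have hreal : ((F.filter (fun x => ¬ P x)).card : ℝ) * ε₀ ^ 3 ≤ 8 * C₃ := by
    have h1 := ENNReal.toReal_mono ENNReal.ofReal_ne_top hcard
    rwa [ENNReal.toReal_mul, ENNReal.toReal_natCast, ENNReal.toReal_ofReal (by positivity),
      ENNReal.toReal_ofReal (by positivity)] at h1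
  have hfarN : (F.filter (fun x => ¬ P x)).card ≤ Nf := by
    refine Nat.le_floor ?_
    rw [le_div_iff₀ (by positivity)]
    exact hreal
  -- ### total
  have htot := Finset.card_filter_add_card_filter_not (s := F) P
  omega

/-! ### Assembly: the registered stub S2 from the window law and the far field -/

/-- **Window quarter law + far-field enstrophy ⇒ UNIFORM SPARSENESS** (the conclusion of the registered stub
S2 `stub_uniformSparseness`, predicate `UniformSparseness T u` of `Lines/sparse_sieve.lean` unfolded
verbatim): for a classical solution on `[0, T)` (`ν, T > 0`), Leray–Hopf on `[0, T]` from a rapidly decaying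
datum, with `∫_a^b ∫ |curl u|² ≤ K √(b − a)` (`0 ≤ a ≤ b ≤ T`) and enstrophy `≤ B` outside `B(0, ρ)` on
`[T/2, T)`: `∃ r₀ > 0, ∀ ε₀ > 0, ∃ N₀, ∀ t ∈ [0, T), ∀ r ∈ (0, r₀]`, every `4r`-separated finite family of
centres `x` with `∫_{B(x, 2r)} |u(t)|³ ≥ ε₀³` has `≤ N₀` members. Three regimes: early times
(`sparse_early_of_lerayHopf`), late times at fine scales (`sparse_fine_of_window`), late times at coarse
scales (`sparse_coarse_of_farField`). [folklore] -/
theorem uniformSparseness_of_window (hν : 0 < ν) (hT : 0 < T)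
    (hsol : IsClassicalNSSolutionOn (Ico 0 T) ν 0 u p) (hLH : IsLerayHopfOn T ν 0 (u 0) u)
    (hdec : HasRapidSpatialDecay (u 0)) {K : ℝ} (hK : 0 ≤ K)
    (hwin : ∀ a b : ℝ, 0 ≤ a → a ≤ b → b ≤ T →
      ∫⁻ t in Ioo a b, ∫⁻ x, ‖curl (u t) x‖ₑ ^ 2 ≤ ENNReal.ofReal (K * Real.sqrt (b - a)))
    {ρ B : ℝ} (hB : 0 ≤ B)
    (hFF : ∀ t ∈ Ico (T / 2) T,
      ∫⁻ x in (ball (0 : EuclideanSpace ℝ (Fin 3)) ρ)ᶜ, ‖curl (u t) x‖ₑ ^ 2 ≤ ENNReal.ofReal B) :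
    ∃ r₀ : ℝ, 0 < r₀ ∧ ∀ ε₀ : ℝ, 0 < ε₀ → ∃ N₀ : ℕ,
      ∀ t ∈ Set.Ico 0 T, ∀ r ∈ Set.Ioc 0 r₀, ∀ F : Finset (EuclideanSpace ℝ (Fin 3)),
        (∀ x ∈ F, ∀ y ∈ F, x ≠ y → 4 * r ≤ dist x y) →
        (∀ x ∈ F, ENNReal.ofReal (ε₀ ^ 3) ≤ ∫⁻ y in Metric.ball x (2 * r), ‖u t y‖ₑ ^ 3) →
        F.card ≤ N₀ := by
  obtain ⟨r₁, hr₁, hfine⟩ := Sparseness.sparse_fine_of_window hν hT hsol hLH hK hwin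
  have hearly := SparsenessEarly.sparse_early_of_lerayHopf hν hsol hLH hdec (T' := T / 2)
    ⟨by positivity, by linarith⟩
  refine ⟨r₁, hr₁, fun ε₀ hε₀ => ?_⟩
  obtain ⟨N₁, ϑ, hϑ, hϑ1, h₁⟩ := hfine ε₀ hε₀
  obtain ⟨N₂, h₂⟩ := hearly ε₀ hε₀
  have hϑr₁ : 0 < ϑ * r₁ := mul_pos hϑ hr₁
  have hϑr₁' : ϑ * r₁ ≤ r₁ := mul_le_of_le_one_left hr₁.le hϑ1
  obtain ⟨N₃, h₃⟩ := sparse_coarse_of_farField hν hsol hLH hB hFF hϑr₁ hϑr₁' ε₀ hε₀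
  refine ⟨N₁ + N₂ + N₃, fun t ht r hr F hsep hconc => ?_⟩
  rcases le_or_gt t (T / 2) with hle | hgt
  · have h := h₂ t ⟨ht.1, hle⟩ r hr.1 F hsep hconc
    omega
  · have ht' : t ∈ Ico (T / 2) T := ⟨hgt.le, ht.2⟩
    rcases le_or_gt r (ϑ * r₁) with hrle | hrgt
    · have h := h₁ t ht' r ⟨hr.1, hrle⟩ F hsep hconc
      omega
    · have h := h₃ t ht' r ⟨hrgt.le, hr.2⟩ F hsep hconc
      omega

end Summit.NavierStokesRegularity.NavierStokesRegularity.Theorems.EnstrophyQuarterLaw.SparsenessCoarse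

end
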